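import Summits.MatrixMultiplication.MatrixMultiplication.Theorems.SoloBlindHThreeSeq

/-!
# Antichain, H-good links, and the pair recursion for all layer sizes (solo-blind, door I1⁗ / (K₃), s80)

Setting of `SoloBlindWindowTwo`: `h : ι → G` (`G` abelian of exponent `3`) zero-sum free on `S`; `soloBlindSeqRep h S k τ`
= the `k`-subsets of `S` with `h`-sum `τ`, `N_k(τ)` its cardinality; `τ` is H-GOOD when no sub-sum over `S` equals `τ + τ`.
Three structural facts valid for ALL layer sizes:
* `soloBlind_rep_antichain` — the representations of `τ` form an antichain (a representation inside another leaves a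
  zero-sum difference);
* `soloBlind_hgood_link_target` — if `T₀` represents `τ` and `A ⊊ T₀`, then the LINK TARGET `τ - h(A)` is H-good on
  `S \\ T₀` (a sub-sum `2(τ - h(A))` there plus `T₀ \\ A` is a zero-sum `3(τ - h(A)) = 0`); so every link of an H-good
  configuration at a representation is again an H-good configuration — the links at a PAIR are the case used below;
* `soloBlind_hgood_pair_le_links` — PAIR RECURSION: if `τ` is H-good and `{x, y}` represents `τ`, every representation
  of size `k + 1 ≥ 3` contains exactly one of `x, y`, whence
  `N_{k+1}(τ; S) ≤ N_k(h y; S \\ {x,y}) + N_k(h x; S \\ {x,y})` with both targets H-good on `S \\ {x,y}`.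
Consequently a diagonal layer bound `H(k) ≤ B` (for all index sets and H-good targets) gives `N_{k+1}(τ) ≤ 2B` on the
stratum `N_2(τ) ≥ 1` (`soloBlind_hgood_pair_layer_le`); with the kernel theorem H(3) = 4 (`SoloBlindHThreeSeq`):
`soloBlind_seqRep_four_card_le_eight_of_pair` — H(4)'s conjectured value `8 = 2³` holds in all ranks whenever `τ` has a
pair representation (the full H(4) = 8 is so far a census theorem).
-/

namespace Summit.MatrixMultiplication.MatrixMultiplication.Theorems

open Finset

variable {ι G : Type*} [DecidableEq ι] [AddCommGroup G] [DecidableEq G]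

/-- ANTICHAIN: for `h` zero-sum free on `S`, no representation of `τ` is properly contained in another. -/
theorem soloBlind_rep_antichain {h : ι → G} {S : Finset ι}
    (zsf : ∀ T ⊆ S, T.Nonempty → ∑ i ∈ T, h i ≠ 0) {τ : G} {k k' : ℕ} {T M : Finset ι}
    (hT : T ∈ soloBlindSeqRep h S k τ) (hM : M ∈ soloBlindSeqRep h S k' τ) (hTM : T ⊆ M) : T = M := by
  obtain ⟨-, -, hTsum⟩ := soloBlind_mem_seqRep.mp hT
  obtain ⟨hMS, -, hMsum⟩ := soloBlind_mem_seqRep.mp hM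
  by_contra hne
  have hsd : (M \ T).Nonempty := Finset.sdiff_nonempty.mpr fun hMT => hne (Finset.Subset.antisymm hTM hMT)
  have e := Finset.sum_sdiff hTM (f := h)
  rw [hMsum, hTsum] at e
  have hz : ∑ i ∈ M \ T, h i = 0 := by
    have e' : ∑ i ∈ M \ T, h i + τ = 0 + τ := by rw [e, zero_add]
    exact add_right_cancel e'
  exact zsf _ (Finset.sdiff_subset.trans hMS) hsd hz

/-- H-GOOD LINKS: if `T₀` represents `τ` and `A ⊊ T₀`, the link target `τ - h(A)` is H-good on `S \ T₀`. -/
theorem soloBlind_hgood_link_target (three : ∀ g : G, g + g + g = 0) {h : ι → G} {S : Finset ι}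
    (zsf : ∀ T ⊆ S, T.Nonempty → ∑ i ∈ T, h i ≠ 0) {τ : G} {m : ℕ} {T₀ A : Finset ι}
    (hT₀ : T₀ ∈ soloBlindSeqRep h S m τ) (hA : A ⊆ T₀) (hAT : A ≠ T₀) :
    ∀ U ⊆ S \ T₀, ∑ i ∈ U, h i ≠ (τ - ∑ i ∈ A, h i) + (τ - ∑ i ∈ A, h i) := by
  obtain ⟨hT₀S, -, hT₀sum⟩ := soloBlind_mem_seqRep.mp hT₀
  intro U hU e
  have hsd : (T₀ \ A).Nonempty := Finset.sdiff_nonempty.mpr fun h' => hAT (Finset.Subset.antisymm hA h')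
  have hdis : Disjoint U (T₀ \ A) := by
    refine Finset.disjoint_left.mpr fun {w} hwU hwT => ?_
    exact (Finset.mem_sdiff.mp (hU hwU)).2 (Finset.mem_sdiff.mp hwT).1
  have eA := Finset.sum_sdiff hA (f := h)
  rw [hT₀sum] at eA
  have hZ : ∑ i ∈ U ∪ (T₀ \ A), h i = 0 := by
    rw [Finset.sum_union hdis, e]
    have e3 : (τ - ∑ i ∈ A, h i) + (τ - ∑ i ∈ A, h i) + ∑ i ∈ T₀ \ A, h i =
        (∑ i ∈ T₀ \ A, h i + ∑ i ∈ A, h i) + (∑ i ∈ T₀ \ A, h i + ∑ i ∈ A, h i) +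
          (∑ i ∈ T₀ \ A, h i + ∑ i ∈ A, h i) - (τ + τ + τ) + (τ + τ + τ)
          - (∑ i ∈ A, h i + ∑ i ∈ A, h i + ∑ i ∈ A, h i) + (τ + τ) - (∑ x ∈ T₀ \ A, h x + ∑ x ∈ A, h x)
          - (∑ x ∈ T₀ \ A, h x + ∑ x ∈ A, h x) := by abel
    rw [e3, eA, three τ, three (∑ i ∈ A, h i)]
    abel
  refine zsf _ (Finset.union_subset (fun w hw => (Finset.mem_sdiff.mp (hU hw)).1)
    (Finset.sdiff_subset.trans hT₀S)) ?_ hZ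
  obtain ⟨w, hw⟩ := hsd
  exact ⟨w, Finset.mem_union_right _ hw⟩

/-- With a pair `{x, y}` representing `τ`, no larger representation contains both `x` and `y` (antichain). -/
theorem soloBlind_pair_not_both {h : ι → G} {S : Finset ι}
    (zsf : ∀ T ⊆ S, T.Nonempty → ∑ i ∈ T, h i ≠ 0) {τ : G} {x y : ι}
    (hP : ({x, y} : Finset ι) ∈ soloBlindSeqRep h S 2 τ) {k : ℕ} (hk : 2 ≤ k) {M : Finset ι}
    (hM : M ∈ soloBlindSeqRep h S (k + 1) τ) (hxM : x ∈ M) (hyM : y ∈ M) : False := by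
  have hsub : ({x, y} : Finset ι) ⊆ M := Finset.insert_subset hxM (Finset.singleton_subset_iff.mpr hyM)
  have e := soloBlind_rep_antichain zsf hP hM hsub
  obtain ⟨-, hPc, -⟩ := soloBlind_mem_seqRep.mp hP
  obtain ⟨-, hMc, -⟩ := soloBlind_mem_seqRep.mp hM
  rw [e, hMc] at hPc
  omega

/-- PAIR RECURSION (all layer sizes): if `τ` is H-good and `{x, y}` represents `τ`, then every representation of
size `k + 1 ≥ 3` passes through exactly one of `x, y`, so
`N_{k+1}(τ; S) ≤ N_k(h y; S ∖ {x,y}) + N_k(h x; S ∖ {x,y})`. -/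
theorem soloBlind_hgood_pair_le_links {h : ι → G} {S : Finset ι}
    (zsf : ∀ T ⊆ S, T.Nonempty → ∑ i ∈ T, h i ≠ 0) {τ : G}
    (hgood : ∀ T ⊆ S, ∑ i ∈ T, h i ≠ τ + τ) {x y : ι}
    (hP : ({x, y} : Finset ι) ∈ soloBlindSeqRep h S 2 τ) {k : ℕ} (hk : 2 ≤ k) :
    (soloBlindSeqRep h S (k + 1) τ).card ≤ (soloBlindSeqRep h (S \ {x, y}) k (h y)).card +
      (soloBlindSeqRep h (S \ {x, y}) k (h x)).card := by
  obtain ⟨hPS, hPc, hPsum⟩ := soloBlind_mem_seqRep.mp hP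
  have hxy : x ≠ y := by
    intro e; rw [e] at hPc; simp at hPc
  rw [Finset.sum_pair hxy] at hPsum
  have link : ∀ {z z' : ι} {M : Finset ι}, ({z, z'} : Finset ι) = {x, y} → h z + h z' = τ →
      M ∈ soloBlindSeqRep h S (k + 1) τ → z ∈ M → z' ∉ M →
      M ∈ (soloBlindSeqRep h (S \ {x, y}) k (h z')).image (fun Q => insert z Q) := by
    intro z z' M hzz' hs hM hzM hz'M
    obtain ⟨hMS, hMc, hMsum⟩ := soloBlind_mem_seqRep.mp hM
    rw [Finset.mem_image]
    refine ⟨M.erase z, ?_, Finset.insert_erase hzM⟩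
    rw [soloBlind_mem_seqRep]
    refine ⟨?_, by rw [Finset.card_erase_of_mem hzM, hMc]; rfl, ?_⟩
    · intro w hw
      rw [Finset.mem_sdiff, ← hzz']
      refine ⟨hMS (Finset.mem_of_mem_erase hw), ?_⟩
      intro hw'
      simp only [Finset.mem_insert, Finset.mem_singleton] at hw'
      rcases hw' with hw' | hw'
      · exact (Finset.mem_erase.mp hw).1 hw'
      · exact hz'M (hw' ▸ Finset.mem_of_mem_erase hw)
    · have e := Finset.add_sum_erase M h hzM
      rw [hMsum, ← hs] at e
      exact add_left_cancel e
  have hcover : soloBlindSeqRep h S (k + 1) τ ⊆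
      (soloBlindSeqRep h (S \ {x, y}) k (h y)).image (fun Q => insert x Q) ∪
        (soloBlindSeqRep h (S \ {x, y}) k (h x)).image (fun Q => insert y Q) := by
    intro M hM
    rw [Finset.mem_union]
    by_cases hxM : x ∈ M
    · have hyM : y ∉ M := fun hyM => soloBlind_pair_not_both zsf hP hk hM hxM hyM
      exact Or.inl (link rfl hPsum hM hxM hyM)
    · have hyM : y ∈ M := by
        by_contra hyM
        refine soloBlind_hgood_not_disjoint hgood hM hP (Finset.disjoint_right.mpr ?_)
        intro w hw
        simp only [Finset.mem_insert, Finset.mem_singleton] at hw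
        rcases hw with hw | hw
        · rw [hw]; exact hxM
        · rw [hw]; exact hyM
      exact Or.inr (link (Finset.pair_comm y x) (by rw [add_comm]; exact hPsum) hM hyM hxM)
  calc (soloBlindSeqRep h S (k + 1) τ).card
      ≤ ((soloBlindSeqRep h (S \ {x, y}) k (h y)).image (fun Q => insert x Q) ∪
          (soloBlindSeqRep h (S \ {x, y}) k (h x)).image (fun Q => insert y Q)).card :=
        Finset.card_le_card hcover
    _ ≤ ((soloBlindSeqRep h (S \ {x, y}) k (h y)).image (fun Q => insert x Q)).card +
          ((soloBlindSeqRep h (S \ {x, y}) k (h x)).image (fun Q => insert y Q)).card :=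
        Finset.card_union_le _ _
    _ ≤ (soloBlindSeqRep h (S \ {x, y}) k (h y)).card +
          (soloBlindSeqRep h (S \ {x, y}) k (h x)).card :=
        Nat.add_le_add Finset.card_image_le Finset.card_image_le

/-- TRANSFER OF A DIAGONAL LAYER BOUND ALONG THE PAIR STRATUM: if `N_k(σ; S') ≤ B` for every `S' ⊆ S` and every
target `σ` that is H-good on `S'`, then `N_{k+1}(τ; S) ≤ 2B` for every H-good `τ` with a pair representation. -/
theorem soloBlind_hgood_pair_layer_le (three : ∀ g : G, g + g + g = 0) {h : ι → G} {S : Finset ι}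
    (zsf : ∀ T ⊆ S, T.Nonempty → ∑ i ∈ T, h i ≠ 0) {τ : G}
    (hgood : ∀ T ⊆ S, ∑ i ∈ T, h i ≠ τ + τ) {x y : ι}
    (hP : ({x, y} : Finset ι) ∈ soloBlindSeqRep h S 2 τ) {k B : ℕ} (hk : 2 ≤ k)
    (hH : ∀ S' ⊆ S, ∀ σ : G, (∀ T ⊆ S', ∑ i ∈ T, h i ≠ σ + σ) → (soloBlindSeqRep h S' k σ).card ≤ B) :
    (soloBlindSeqRep h S (k + 1) τ).card ≤ 2 * B := by
  obtain ⟨hPS, -, -⟩ := soloBlind_mem_seqRep.mp hP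
  have hxS : x ∈ S := hPS (Finset.mem_insert_self _ _)
  have hyS : y ∈ S := hPS (Finset.mem_insert_of_mem (Finset.mem_singleton_self _))
  have hS' : S \ {x, y} ⊆ S := Finset.sdiff_subset
  have hxS' : x ∉ S \ {x, y} := fun hx => (Finset.mem_sdiff.mp hx).2 (Finset.mem_insert_self _ _)
  have hyS' : y ∉ S \ {x, y} := fun hy =>
    (Finset.mem_sdiff.mp hy).2 (Finset.mem_insert_of_mem (Finset.mem_singleton_self _))
  have b₁ := hH _ hS' (h y) (soloBlind_hgood_of_outside_value three zsf hS' hyS hyS')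
  have b₂ := hH _ hS' (h x) (soloBlind_hgood_of_outside_value three zsf hS' hxS hxS')
  have := soloBlind_hgood_pair_le_links zsf hgood hP hk
  omega

/-- H(4) ON THE PAIR STRATUM, ALL RANKS: for `h` zero-sum free on `S` (exponent-3 group) and `τ` H-good with a pair
representation, at most `8 = 2³` four-subsets of `S` have `h`-sum `τ` (from the kernel theorem H(3) = 4). -/
theorem soloBlind_seqRep_four_card_le_eight_of_pair (three : ∀ g : G, g + g + g = 0) (h : ι → G)
    (S : Finset ι) (zsf : ∀ T ⊆ S, T.Nonempty → ∑ i ∈ T, h i ≠ 0) (τ : G)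
    (hgood : ∀ T ⊆ S, ∑ i ∈ T, h i ≠ τ + τ) {x y : ι} (hP : ({x, y} : Finset ι) ∈ soloBlindSeqRep h S 2 τ) :
    (soloBlindSeqRep h S 4 τ).card ≤ 8 := by
  have := soloBlind_hgood_pair_layer_le three zsf hgood hP (k := 3) (B := 4) (by norm_num)
    (fun S' hS' σ hσ => soloBlind_seqRep_three_card_le_four_of_hgood three h S'
      (fun T hT hne => zsf T (hT.trans hS') hne) σ hσ)
  omega

/-- The same transfer one level down recovers `N_3 ≤ 2·H(2) = 4` on the pair stratum from H(2) = 2 (the sharp value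
there is `2`, `soloBlind_hgood_pair_triples_le_two`); recorded as a consistency check of the recursion. -/
theorem soloBlind_seqRep_three_card_le_four_of_pair (three : ∀ g : G, g + g + g = 0) (h : ι → G)
    (S : Finset ι) (zsf : ∀ T ⊆ S, T.Nonempty → ∑ i ∈ T, h i ≠ 0) (τ : G)
    (hgood : ∀ T ⊆ S, ∑ i ∈ T, h i ≠ τ + τ) {x y : ι} (hP : ({x, y} : Finset ι) ∈ soloBlindSeqRep h S 2 τ) :
    (soloBlindSeqRep h S 3 τ).card ≤ 4 := by
  have := soloBlind_hgood_pair_layer_le three zsf hgood hP (k := 2) (B := 2) le_rfl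
    (fun S' hS' σ hσ => soloBlind_seqRep_two_card_le_two_of_hgood three h S'
      (fun T hT hne => zsf T (hT.trans hS') hne) σ hσ)
  omega

end Summit.MatrixMultiplication.MatrixMultiplication.Theorems
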